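import Mathlib.RepresentationTheory.Invariants
import Mathlib.RepresentationTheory.Subrepresentation
import Mathlib.LinearAlgebra.PID
import Mathlib.LinearAlgebra.Charpoly.ToMatrix
import Mathlib.LinearAlgebra.Dimension.OrzechProperty
import Mathlib.RingTheory.PowerSeries.Expand
import Mathlib.Algebra.Polynomial.Expand
import Literature.AlgebraicGeometry.Motives.FrobeniusTraceProofs
import HarnessLib

/-!
# The Euler factor of an induced representation (Artin 1931, §2; Neukirch VII (10.4) (iv))

Topic `Literature/RepresentationTheory/FiniteGroups`, namespace `Literature.RepTheory`.  This file
proves, for a **finite group** `G`, the representation-theoretic identity at the heart of the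
invariance of Artin L-series under induction (Neukirch, *Algebraic Number Theory*, VII
Prop. (10.4) (iv): `𝓛(L|M, χ, s) = 𝓛(L|K, χ_*, s)`; E. Artin, *Zur Theorie der L-Reihen mit
allgemeinen Gruppencharakteren*, Abh. Math. Sem. Hamburg 8 (1931), §2).  In Neukirch's proof
(pp. 522–524: `G = G(L|K)`, `H = G(L|M)`, `𝔓ᵢ = 𝔓₁^{τᵢ}`, `Gᵢ = τᵢ⁻¹G₁τᵢ`, `Iᵢ = τᵢ⁻¹I₁τᵢ`,
`Hᵢ = Gᵢ ∩ H`, `I'ᵢ = Iᵢ ∩ H`, `fᵢ = (Gᵢ : HᵢIᵢ)`, `φᵢ = τᵢ⁻¹ φ τᵢ`) "what we have to show is"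

> `det(1 - φt; V^{I₁}) = ∏ᵢ det(1 - φᵢ^{fᵢ} t^{fᵢ}; W^{I'ᵢ})`, `V = Ind(W)`.

This is `Literature.RepresentationTheory.FiniteGroups.reverse_charpoly_restrict_invariants_eq_prod` below, stated for an
arbitrary finite group `G`, subgroups `H ≤ G` and `I ⊴ D ≤ G` with `D = ⋃ₐ φ^a I`
(decomposition group, inertia group and a Frobenius lift `φ`), a system `τ : ι → G` of
representatives of the double cosets `D \ G / H` (the primes of `M` above `𝔭`,
Neukirch I §9), and for each `i` an element `φ'ᵢ ∈ H ∩ τᵢ⁻¹ φ^{fᵢ} I τᵢ` where `τᵢ⁻¹ φ^m I τᵢ`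
meets `H` only if `fᵢ ∣ m` (a Frobenius of `𝔓ᵢ` over `M` and the residue degree `fᵢ` of `𝔮ᵢ`
over `𝔭`; note that `φᵢ^{fᵢ}` itself lies in `H` only modulo `Iᵢ`, which is why the statement
quantifies over `φ'ᵢ`).  The representation `V` of `G` is **induced** from the `H`-stable
subspace `W₀` in Serre's sense (*Linear Representations of Finite Groups*, §3.3:
`V = ⊕_{σ ∈ G/H} σ W₀`), expressed by the two hypotheses "the translates `ρ(g) W₀` span `V`"
and "`dim V = [G:H] dim W₀`" (the form produced by
`Literature.RepresentationTheory.FiniteGroups.InducedRecognition`); `W₀` is a Mathlib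
`Subrepresentation (ρ.comp H.subtype)`, the fixed spaces are Mathlib's
`Representation.invariants (ρ.comp J.subtype)` (definitionally the tree's
`Literature.NumberTheory.GaloisRepresentations.ContinuousRep.fixedSubmodule` / `Literature.NumberTheory.GaloisRepresentations.Representation.fixedSubmodule`), and the Euler
polynomials are `(LinearMap.charpoly _).reverse = det(1 - tA)` as in
`Literature.NumberTheory.GaloisRepresentations.ArtinRep.eulerPolynomial`; `t ↦ t^{fᵢ}` is `Polynomial.expand`.

## Proof

Instead of Neukirch's reduction to `r = 1`, `I = 1` and the block-companion determinant, we
follow Artin's original route through traces (logarithms of Euler factors):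

1. `det(1 - tA)` is determined by the traces `tr(A^m)`:
   `exp(∑_{m ≥ 1} tr(A^m) t^m/m) · det(1 - tA) = 1` in `k⟦t⟧` (Deligne, *Weil I*, (1.5.3);
   proved in `Literature.AlgebraicGeometry.Motives.FrobeniusTraceProofs`).  Hence
   (`reverse_charpoly_eq_prod_expand_of_trace_pow`) the determinant identity follows from the
   trace identities `tr(φ^m | V^I) = ∑ᵢ [fᵢ ∣ m] fᵢ tr(φ'ᵢ^{m/fᵢ} | W₀^{I'ᵢ})`, `m ≥ 1`
   (`PowerSeries.expand`, `exp_subst_sum`).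
2. Averaging (`card_mul_trace_restrict_inf_invariants`): for a finite subgroup `J` and a
   `J`-stable subspace `U`, `|J| tr(A | U ∩ V^J) = ∑_{j ∈ J} tr(A ρ(j) | U)`
   (the operator `∑_j ρ(j)` maps `U` into `U ∩ V^J` and is `|J|` there; Serre §2.6).
3. The character of an induced representation (`trace_eq_sum_quotient`, Serre §3.3 Thm. 12 /
   §7.2): `tr ρ(x) = ∑_{c ∈ G/H, c⁻¹xc ∈ H} tr(ρ(c⁻¹ x c) | W₀)`, computed in the basis
   `{ρ(c) bₛ}` of `V` (`linearIndependent_translate_basis`).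
4. Group-theoretic bookkeeping for `x = φ^m y`, `y ∈ I`: the local sums
   `S(t) = ∑_{y ∈ I} [t⁻¹ φ^m y t ∈ H] tr(ρ(t⁻¹ φ^m y t) | W₀)` are left `D`- and right
   `H`-invariant (`sum_ite_conj_mem_eq_of_mem`, `ite_conj_mem_mul_eq`), so the sum over
   `G/H` regroups over the `D`-orbits `D · τᵢH` (`sum_quotient_out_eq_sum_card_orbit_smul`);
   at `t = τᵢ` one has `τᵢ⁻¹ φ^m I τᵢ ∩ H = φ'ᵢ^{m/fᵢ} (H ∩ τᵢ⁻¹ I τᵢ)` if `fᵢ ∣ m` and `= ∅`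
   otherwise (`sum_ite_conj_mem_eq_ite_dvd`); and the orbit has
   `|D · τᵢH| · |H ∩ τᵢ⁻¹ I τᵢ| = fᵢ |I|` elements-times-inertia (`card_orbit_mul_card_eq`, via
   the parametrisation `(a, y) ↦ φ^a y τᵢ H`, `0 ≤ a < fᵢ`, `y ∈ I`).  Assembling
   (`trace_pow_restrict_invariants_eq_sum`) and cancelling `|I|` (characteristic zero) gives
   the trace identities.

The maps-to facts needed to restrict `ρ(φ)` to `V^I` and `ρ(φ'ᵢ)` to `W₀ ∩ V^{H ∩ τᵢ⁻¹Iτᵢ}`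
are `mapsTo_invariants_of_conj_mem` and `mapsTo_inf_invariants_of_frobenius`;
`reverse_charpoly_restrict_invariants_eq_prod'` is the hypothesis-free-of-`MapsTo` form.

This is the finite-group input for discharging the named fact
`Literature.NumberTheory.GaloisRepresentations.artinLFunction_eq_of_isInducedFrom` (`Literature.NumberTheory.GaloisRepresentations.ArtinFormalism`,
Neukirch VII (10.4) (iv)); the remaining steps there are the passage from `Γ_K` to a finite
quotient, the Serre datum on Mathlib's `Representation.IndV`, and the regrouping of the Euler
product over the primes of `M`.

## Mathlib / tree search

Mathlib (this pin) has `Representation.invariants`, `Subrepresentation.toRepresentation`,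
`LinearMap.trace_restrict_eq_of_forall_mem`, `LinearMap.trace_eq_matrix_trace`,
`linearIndependent_of_top_le_span_of_card_eq_finrank`, `Module.End.pow_restrict`,
`PowerSeries.expand` (`coeff_expand`, `expand_subst`), `Polynomial.expand`, `DoubleCoset`, but
no induced-character formula at module level, no Mackey formula and nothing on invariants of
induced modules (grep `Mackey`, `character_ind`, `inertia` in `RepresentationTheory`: nothing).
In the tree, `Literature.RepresentationTheory.FiniteGroups.InducedClassFunction` treats induced
*class functions* `G → ℂ` (Frobenius reciprocity), not modules; `InducedRecognition` recognises
Mathlib's `ind`.  No definition is introduced here (theorems only).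

## References

* E. Artin, *Zur Theorie der L-Reihen mit allgemeinen Gruppencharakteren*, Abh. Math. Sem.
  Univ. Hamburg 8 (1931), 292–306, §2 (`ArtinHamburg1931`).
* J. Neukirch, *Algebraic Number Theory*, Grundlehren 322, Springer (1999), Ch. VII §10,
  Prop. (10.4) (iv) and its proof, pp. 522–524 (`NeukirchANT1999`).
* J.-P. Serre, *Linear Representations of Finite Groups*, GTM 42 (1977), §2.6, §3.3 (Thm. 12),
  §7.2 (`SerreLinearRepresentations1977`).
* P. Deligne, *La conjecture de Weil. I*, Publ. Math. IHÉS 43 (1974), (1.5.3).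
-/

open PowerSeries

namespace Literature.RepresentationTheory.FiniteGroups

/-! ### From traces of powers to reversed characteristic polynomials -/

section TraceToDet

variable {k : Type*} [Field k]

/-- Expanding the coercion of a polynomial to power series is the coercion of the expanded
polynomial. [folklore] -/
theorem expand_coe_polynomial (p : ℕ) (hp : p ≠ 0) (P : Polynomial k) :
    PowerSeries.expand p hp (P : PowerSeries k) =
      ((Polynomial.expand k p P : Polynomial k) : PowerSeries k) := by
  ext n
  rw [PowerSeries.coeff_expand, Polynomial.coeff_coe, Polynomial.coeff_coe,
    Polynomial.coeff_expand (Nat.pos_of_ne_zero hp)]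

variable [CharZero k]
  {V : Type*} [AddCommGroup V] [Module k V] [FiniteDimensional k V]
  {ι : Type*} [Fintype ι] {W : ι → Type*} [∀ i, AddCommGroup (W i)] [∀ i, Module k (W i)]
  [∀ i, FiniteDimensional k (W i)]

/-- The logarithmic trace series `L_f = ∑_{m ≥ 1} tr(f^m) X^m / m` has no constant term.
[folklore] -/
theorem constantCoeff_endTraceLogSeries {M : Type*} [AddCommGroup M] [Module k M] (f : M →ₗ[k] M) :
    constantCoeff (PowerSeries.mk fun m => (m : ℚ)⁻¹ • LinearMap.trace k M (f ^ m)) = 0 := by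
  rw [← coeff_zero_eq_constantCoeff_apply, coeff_mk, Nat.cast_zero, inv_zero, zero_smul]

/-- **Expanded trace identity.**  For an endomorphism `B` of a finite-dimensional space and
`p ≥ 1`: `exp(∑_{m} tr(B^m) X^{pm}/m) · det(1 - X^p B) = 1`, i.e. the identity
`exp(L_B) det(1 - X B) = 1` (Deligne (1.5.3), `Literature.FrobeniusTrace`) pushed through `X ↦ X^p`.
[folklore] -/
theorem exp_subst_expand_mul_expand_reverse_charpoly {M : Type*} [AddCommGroup M] [Module k M]
    [FiniteDimensional k M] (B : M →ₗ[k] M) (p : ℕ) (hp : p ≠ 0) :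
    (exp k).subst (PowerSeries.expand p hp
        (PowerSeries.mk fun m => (m : ℚ)⁻¹ • LinearMap.trace k M (B ^ m))) *
      ((Polynomial.expand k p B.charpoly.reverse : Polynomial k) : PowerSeries k) = 1 := by
  have h := Literature.AlgebraicGeometry.Motives.FrobeniusTrace.exp_subst_endTraceLogSeries_mul_reverse_charpoly (R := k) B
  apply_fun PowerSeries.expand p hp at h
  rw [map_mul, map_one, expand_coe_polynomial] at h
  rw [← h]
  congr 1
  change _ = MvPowerSeries.expand p hp (PowerSeries.subst _ (exp k))
  rw [PowerSeries.expand_subst p hp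
    (HasSubst.of_constantCoeff_zero' (constantCoeff_endTraceLogSeries B))]
  rfl

/-- **Traces of powers determine `det(1 - X f)` — product form.**  Let `A` be an endomorphism
of a finite-dimensional vector space over a field of characteristic zero, and `B i`
(`i ∈ ι`, finite) endomorphisms of finite-dimensional spaces, `f i ≥ 1` integers, such that
`tr(A^m) = ∑_i [f i ∣ m] · f i · tr(B_i^{m / f i})` for all `m ≥ 1`.  Then
`det(1 - X A) = ∏_i det(1 - X^{f i} B_i)`, i.e.
`A.charpoly.reverse = ∏ i, expand (f i) (B i).charpoly.reverse`.  Proof: both sides are the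
inverse of `exp(∑_m tr(A^m) X^m/m) = ∏_i exp(∑_m tr(B_i^m) X^{f_i m}/m)` in `k⟦X⟧`.
Ref: Artin (1931), §2; Neukirch, *Algebraic Number Theory*, VII §10, proof of (10.4) (iv)
(the logarithmic form of the Euler factors). [folklore] -/
theorem reverse_charpoly_eq_prod_expand_of_trace_pow (A : V →ₗ[k] V) (B : ∀ i, W i →ₗ[k] W i)
    (f : ι → ℕ) (hf : ∀ i, f i ≠ 0)
    (h : ∀ m : ℕ, 0 < m → LinearMap.trace k V (A ^ m) =
      ∑ i, if f i ∣ m then (f i : k) * LinearMap.trace k (W i) (B i ^ (m / f i)) else 0) :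
    A.charpoly.reverse = ∏ i, Polynomial.expand k (f i) (B i).charpoly.reverse := by
  -- the trace series of `A` is the sum of the expanded trace series of the `B i`
  set LA : PowerSeries k := PowerSeries.mk fun m => (m : ℚ)⁻¹ • LinearMap.trace k V (A ^ m)
    with hLA
  set LB : ι → PowerSeries k := fun i => PowerSeries.expand (f i) (hf i)
    (PowerSeries.mk fun m => (m : ℚ)⁻¹ • LinearMap.trace k (W i) (B i ^ m)) with hLB
  have hsum : LA = ∑ i, LB i := by
    ext m
    simp only [hLA, hLB, coeff_mk, map_sum, PowerSeries.coeff_expand]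
    rcases Nat.eq_zero_or_pos m with rfl | hm
    · simp
    · rw [h m hm, Finset.smul_sum]
      refine Finset.sum_congr rfl fun i _ => ?_
      split_ifs with hd
      · obtain ⟨q, rfl⟩ := hd
        have hq : (q : ℚ) ≠ 0 := by
          rintro hq0
          rw [Nat.cast_eq_zero] at hq0
          subst hq0
          simp at hm
        have hfi : (f i : ℚ) ≠ 0 := Nat.cast_ne_zero.mpr (hf i)
        rw [Nat.mul_div_cancel_left q (Nat.pos_of_ne_zero (hf i)), Algebra.smul_def,
          Algebra.smul_def, Nat.cast_mul, mul_inv, map_mul, map_inv₀, map_inv₀, map_natCast,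
          map_natCast]
        have hfk : (f i : k) ≠ 0 := Nat.cast_ne_zero.mpr (hf i)
        field_simp
      · rw [smul_zero]
  have hLB0 : ∀ i ∈ (Finset.univ : Finset ι), constantCoeff (LB i) = 0 := fun i _ => by
    rw [hLB]
    dsimp only
    rw [PowerSeries.constantCoeff_expand, constantCoeff_endTraceLogSeries]
  -- `exp(L_A) · A.charpoly.reverse = 1` and `exp(L_A) · ∏ expand … = 1`
  have h1 := Literature.AlgebraicGeometry.Motives.FrobeniusTrace.exp_subst_endTraceLogSeries_mul_reverse_charpoly (R := k) A
  rw [← hLA] at h1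
  have h2 : (exp k).subst LA *
      ∏ i, ((Polynomial.expand k (f i) (B i).charpoly.reverse : Polynomial k) : PowerSeries k) =
        1 := by
    rw [hsum, Literature.AlgebraicGeometry.Motives.FrobeniusTrace.exp_subst_sum _ _ hLB0, ← Finset.prod_mul_distrib]
    refine Finset.prod_eq_one fun i _ => ?_
    rw [hLB]
    exact exp_subst_expand_mul_expand_reverse_charpoly (B i) (f i) (hf i)
  have h3 : ((A.charpoly.reverse : Polynomial k) : PowerSeries k) =
      ∏ i, ((Polynomial.expand k (f i) (B i).charpoly.reverse : Polynomial k) : PowerSeries k) := by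
    calc ((A.charpoly.reverse : Polynomial k) : PowerSeries k)
        = (A.charpoly.reverse : PowerSeries k) * ((exp k).subst LA * ∏ i,
            ((Polynomial.expand k (f i) (B i).charpoly.reverse : Polynomial k) :
              PowerSeries k)) := by rw [h2, mul_one]
      _ = ((exp k).subst LA * (A.charpoly.reverse : PowerSeries k)) * ∏ i,
            ((Polynomial.expand k (f i) (B i).charpoly.reverse : Polynomial k) :
              PowerSeries k) := by ring
      _ = _ := by rw [h1, one_mul]
  have h4 : ((∏ i, Polynomial.expand k (f i) (B i).charpoly.reverse : Polynomial k) :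
      PowerSeries k) =
      ∏ i, ((Polynomial.expand k (f i) (B i).charpoly.reverse : Polynomial k) : PowerSeries k) :=
    map_prod (Polynomial.coeToPowerSeries.ringHom (R := k)) _ _
  rw [← h4, Polynomial.coe_inj] at h3
  exact h3

end TraceToDet

/-! ### Averaging over a finite subgroup: traces on invariants -/

section Averaging

variable {k : Type*} [Field k] {G : Type*} [Group G]
  {V : Type*} [AddCommGroup V] [Module k V]
  (ρ : Representation k G V)

/-- `∑_{j ∈ J} ρ(j) v` is `J`-invariant. [folklore] -/
theorem sum_apply_mem_invariants (J : Subgroup G) [Fintype J] (v : V) :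
    (∑ j : J, ρ j v) ∈ Representation.invariants (ρ.comp J.subtype) := by
  rw [Representation.mem_invariants]
  intro j'
  rw [map_sum]
  simp only [MonoidHom.coe_comp, Function.comp_apply, Subgroup.subtype_apply]
  simp_rw [← Module.End.mul_apply, ← map_mul]
  exact Fintype.sum_equiv (Equiv.mulLeft j') _ _ fun j => by simp

/-- On `J`-invariant vectors, `∑_{j ∈ J} ρ(j) v = |J| v`. [folklore] -/
theorem sum_apply_eq_card_smul (J : Subgroup G) [Fintype J] {v : V}
    (hv : v ∈ Representation.invariants (ρ.comp J.subtype)) :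
    (∑ j : J, ρ j v) = (Fintype.card J : k) • v := by
  have h : ∀ j : J, ρ j v = v := fun j => (Representation.mem_invariants _ _).mp hv j
  simp only [h, Finset.sum_const, Finset.card_univ, Nat.cast_smul_eq_nsmul]

variable [FiniteDimensional k V]

/-- **Averaging formula for traces on invariants.**  Let `J ≤ G` be a finite subgroup, `U ⊆ V`
a `J`-stable subspace and `A` an endomorphism of `V` preserving `U ∩ V^J` and such that each
`A ρ(j)` preserves `U`.  Then `|J| · tr(A | U ∩ V^J) = ∑_{j ∈ J} tr(A ρ(j) | U)`: the
operator `P = ∑_j ρ(j)` maps `U` into `U ∩ V^J` and is `|J|` on `V^J`.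
Ref: Serre, *Linear Representations of Finite Groups*, §2.6 (the projector `(1/|G|) ∑ ρ(g)`);
Neukirch, *Algebraic Number Theory*, VII §10, proof of (10.4) (iv). [folklore] -/
theorem card_mul_trace_restrict_inf_invariants (J : Subgroup G) [Fintype J] (U : Submodule k V)
    (hU : ∀ j : J, ∀ u ∈ U, ρ j u ∈ U) (A : V →ₗ[k] V)
    (hA : Set.MapsTo A ↑(U ⊓ Representation.invariants (ρ.comp J.subtype)) ↑(U ⊓ Representation.invariants (ρ.comp J.subtype)))
    (hAj : ∀ j : J, Set.MapsTo (A ∘ₗ ρ j) U U) :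
    (Fintype.card J : k) * LinearMap.trace k _ (A.restrict hA) =
      ∑ j : J, LinearMap.trace k U ((A ∘ₗ ρ j).restrict (hAj j)) := by
  classical
  set UJ := U ⊓ Representation.invariants (ρ.comp J.subtype) with hUJ
  set P : V →ₗ[k] V := ∑ j : J, ρ j with hP
  have hPapply : ∀ v, P v = ∑ j : J, ρ j v := fun v => by simp [hP, LinearMap.sum_apply]
  have hP1 : ∀ v, P v ∈ Representation.invariants (ρ.comp J.subtype) := fun v => by
    rw [hPapply]; exact sum_apply_mem_invariants ρ J v
  have hP2 : ∀ v ∈ Representation.invariants (ρ.comp J.subtype), P v = (Fintype.card J : k) • v :=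
    fun v hv => by rw [hPapply]; exact sum_apply_eq_card_smul ρ J hv
  have hPU : ∀ u ∈ U, P u ∈ U := fun u hu => by
    rw [hPapply]; exact Submodule.sum_mem _ fun j _ => hU j u hu
  have hT' : ∀ u ∈ U, (A ∘ₗ P) u ∈ UJ := fun u hu => hA ⟨hPU u hu, hP1 u⟩
  have hT : ∀ u ∈ U, (A ∘ₗ P) u ∈ U := fun u hu => (hT' u hu).1
  set T : U →ₗ[k] U := (A ∘ₗ P).restrict hT with hTdef
  -- (i) `T = ∑_j (A ρ j)|_U`
  have h1 : T = ∑ j : J, (A ∘ₗ ρ j).restrict (hAj j) := by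
    ext u
    simp [hTdef, LinearMap.restrict_apply, LinearMap.sum_apply, hPapply, map_sum]
  -- (ii) `T` takes values in `UJ`
  let UJ' : Submodule k U := UJ.comap U.subtype
  have hT2 : ∀ x : U, T x ∈ UJ' := fun x => by
    simpa [UJ', hTdef, LinearMap.restrict_apply] using hT' x x.2
  have h2 := LinearMap.trace_restrict_eq_of_forall_mem UJ' T hT2
  -- (iii) on `UJ`, `T` is `|J| • A`
  let e : UJ' ≃ₗ[k] UJ := Submodule.comapSubtypeEquivOfLe inf_le_left
  have h3 : e.conj (T.restrict fun x _ => hT2 x) = (Fintype.card J : k) • A.restrict hA := by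
    ext ⟨v, hv⟩
    simp only [LinearEquiv.conj_apply, LinearMap.coe_comp, LinearEquiv.coe_coe,
      Function.comp_apply, LinearMap.smul_apply]
    change ((A ∘ₗ P) v) = (Fintype.card J : k) • A v
    rw [LinearMap.comp_apply, hP2 v hv.2, map_smul]
  calc (Fintype.card J : k) * LinearMap.trace k UJ (A.restrict hA)
      = LinearMap.trace k UJ ((Fintype.card J : k) • A.restrict hA) := by
        rw [map_smul, smul_eq_mul]
    _ = LinearMap.trace k UJ (e.conj (T.restrict fun x _ => hT2 x)) := by rw [h3]
    _ = LinearMap.trace k UJ' (T.restrict fun x _ => hT2 x) := LinearMap.trace_conj' _ e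
    _ = LinearMap.trace k U T := h2
    _ = ∑ j : J, LinearMap.trace k U ((A ∘ₗ ρ j).restrict (hAj j)) := by rw [h1, map_sum]

/-- **Averaging formula, whole space.**  For a finite subgroup `J ≤ G` and an endomorphism `A`
of `V` preserving `V^J`: `|J| · tr(A | V^J) = ∑_{j ∈ J} tr(A ρ(j))`.
Ref: Serre, *Linear Representations of Finite Groups*, §2.6. [folklore] -/
theorem card_mul_trace_restrict_invariants (J : Subgroup G) [Fintype J] (A : V →ₗ[k] V)
    (hA : Set.MapsTo A ↑(Representation.invariants (ρ.comp J.subtype))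
      ↑(Representation.invariants (ρ.comp J.subtype))) :
    (Fintype.card J : k) * LinearMap.trace k _ (A.restrict hA) =
      ∑ j : J, LinearMap.trace k V (A ∘ₗ ρ j) := by
  have hA' : Set.MapsTo A ↑((⊤ : Submodule k V) ⊓ Representation.invariants (ρ.comp J.subtype))
      ↑((⊤ : Submodule k V) ⊓ Representation.invariants (ρ.comp J.subtype)) := by
    simpa only [top_inf_eq] using hA
  have h := card_mul_trace_restrict_inf_invariants ρ J ⊤ (fun _ _ _ => trivial) A hA'
    (fun j _ _ => trivial)
  let e : ((⊤ : Submodule k V) ⊓ Representation.invariants (ρ.comp J.subtype) : Submodule k V) ≃ₗ[k]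
      Representation.invariants (ρ.comp J.subtype) := LinearEquiv.ofEq _ _ (top_inf_eq _)
  have h1 : e.conj (A.restrict hA') = A.restrict hA := by
    ext ⟨v, hv⟩
    rfl
  rw [← h1, LinearMap.trace_conj'] 
  rw [h]
  refine Finset.sum_congr rfl fun j _ => ?_
  exact LinearMap.trace_restrict_eq_of_forall_mem ⊤ _ (fun _ => trivial) _

end Averaging

/-! ### Group-theoretic combinatorics of `D = ⟨φ⟩ I` acting on `G/H` -/

section Combinatorics

variable {G : Type*} [Group G] {M : Type*} [AddCommMonoid M]
  {H D I : Subgroup G} {φ : G}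

/-- If `I ⊴ D`, `φ ∈ D` and `D = ⋃_a φ^a I`, then `D/I` is abelian: `d⁻¹ φ^m d ∈ φ^m I` for
`d ∈ D`. [folklore] -/
theorem exists_inv_mul_pow_mul_eq (hIn : ∀ d ∈ D, ∀ y ∈ I, d⁻¹ * y * d ∈ I) (hφ : φ ∈ D)
    (hgen : ∀ d ∈ D, ∃ a : ℕ, ∃ y ∈ I, d = φ ^ a * y) {d : G} (hd : d ∈ D) (m : ℕ) :
    ∃ y' ∈ I, d⁻¹ * φ ^ m * d = φ ^ m * y' := by
  obtain ⟨a, y₁, hy₁, rfl⟩ := hgen d hd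
  have hy₁D : y₁ ∈ D := by
    have : φ ^ a * y₁ ∈ D := hd
    simpa using D.mul_mem (D.inv_mem (D.pow_mem hφ a)) this
  refine ⟨(φ ^ m)⁻¹ * y₁⁻¹ * φ ^ m * y₁, I.mul_mem (hIn _ (D.pow_mem hφ m) _ (I.inv_mem hy₁)) hy₁, ?_⟩
  rw [show φ ^ m * ((φ ^ m)⁻¹ * y₁⁻¹ * φ ^ m * y₁) = y₁⁻¹ * φ ^ m * y₁ by group, mul_inv_rev,
    show y₁⁻¹ * (φ ^ a)⁻¹ * φ ^ m * (φ ^ a * y₁) = y₁⁻¹ * ((φ ^ a)⁻¹ * φ ^ m * φ ^ a) * y₁ by group,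
    ← zpow_natCast φ a, ← zpow_natCast φ m]
  group

/-- Powers of a Frobenius `φ' ∈ τ⁻¹ φ^f I τ`: `φ'^q ∈ τ⁻¹ φ^{fq} I τ`. [folklore] -/
theorem exists_pow_eq_conj (hIn : ∀ d ∈ D, ∀ y ∈ I, d⁻¹ * y * d ∈ I) (hφ : φ ∈ D)
    {τ φ' : G} {f : ℕ} (hφ'I : ∃ y ∈ I, φ' = τ⁻¹ * (φ ^ f * y * τ)) (q : ℕ) :
    ∃ y₁ ∈ I, φ' ^ q = τ⁻¹ * (φ ^ (f * q) * y₁ * τ) := by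
  obtain ⟨y₀, hy₀, hφ'⟩ := hφ'I
  induction q with
  | zero => exact ⟨1, I.one_mem, by group⟩
  | succ q ih =>
    obtain ⟨y₁, hy₁, hq⟩ := ih
    refine ⟨(φ ^ f)⁻¹ * y₁ * φ ^ f * y₀,
      I.mul_mem (hIn _ (D.pow_mem hφ f) _ hy₁) hy₀, ?_⟩
    rw [pow_succ, hq, hφ', Nat.mul_succ, pow_add]
    group

/-- **Left `D`-invariance.**  The sums `S(t) = ∑_{y ∈ I} [t⁻¹ φ^m y t ∈ H] F(t⁻¹ φ^m y t)` only
depend on the coset `Dt`. [folklore] -/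
theorem sum_ite_conj_mem_eq_of_mem [Fintype I] [DecidablePred (· ∈ H)]
    (hIn : ∀ d ∈ D, ∀ y ∈ I, d⁻¹ * y * d ∈ I) (hφ : φ ∈ D)
    (hgen : ∀ d ∈ D, ∃ a : ℕ, ∃ y ∈ I, d = φ ^ a * y) (F : G → M) (m : ℕ) (t : G) {d : G}
    (hd : d ∈ D) :
    (∑ y : I, if (d * t)⁻¹ * (φ ^ m * y * (d * t)) ∈ H then F ((d * t)⁻¹ * (φ ^ m * y * (d * t)))
      else 0) =
    ∑ y : I, if t⁻¹ * (φ ^ m * y * t) ∈ H then F (t⁻¹ * (φ ^ m * y * t)) else 0 := by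
  obtain ⟨y', hy', hdy'⟩ := exists_inv_mul_pow_mul_eq hIn hφ hgen hd m
  let e : I → I := fun y => ⟨y' * (d⁻¹ * y * d), I.mul_mem hy' (hIn d hd y y.2)⟩
  have he : Function.Bijective e := by
    refine (Finite.injective_iff_bijective (f := e)).mp fun y₁ y₂ h => ?_
    have h' := congrArg Subtype.val h
    simp only [e] at h'
    exact Subtype.ext (by simpa using h')
  refine Fintype.sum_bijective e he _ _ fun y => ?_
  have hconj : (d * t)⁻¹ * (φ ^ m * y * (d * t)) = t⁻¹ * (φ ^ m * (e y : G) * t) := by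
    simp only [e]
    rw [show φ ^ m * (y' * (d⁻¹ * ↑y * d)) = (φ ^ m * y') * (d⁻¹ * ↑y * d) by group, ← hdy']
    group
  rw [hconj]

/-- **Right `H`-invariance.**  For `F` invariant under `H`-conjugation on `H`, the summand
`[t⁻¹ x t ∈ H] F(t⁻¹ x t)` only depends on the coset `tH`. [folklore] -/
theorem ite_conj_mem_mul_eq [DecidablePred (· ∈ H)] (F : G → M)
    (hF : ∀ h ∈ H, ∀ w ∈ H, F (h⁻¹ * (w * h)) = F w) (x t : G) {h : G} (hh : h ∈ H) :
    (if (t * h)⁻¹ * (x * (t * h)) ∈ H then F ((t * h)⁻¹ * (x * (t * h))) else 0) =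
      if t⁻¹ * (x * t) ∈ H then F (t⁻¹ * (x * t)) else 0 := by
  have hconj : (t * h)⁻¹ * (x * (t * h)) = h⁻¹ * ((t⁻¹ * (x * t)) * h) := by group
  rw [hconj]
  by_cases hx : t⁻¹ * (x * t) ∈ H
  · rw [if_pos hx, if_pos, hF h hh _ hx]
    exact H.mul_mem (H.inv_mem hh) (H.mul_mem hx hh)
  · rw [if_neg hx, if_neg]
    intro h'
    apply hx
    have := H.mul_mem (H.mul_mem hh h') (H.inv_mem hh)
    simpa [mul_assoc] using this

/-- **Evaluation at a double-coset representative.**  Let `φ' ∈ H ∩ τ⁻¹ φ^f I τ` with `f ≠ 0`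
minimal in the sense that `τ⁻¹ φ^m I τ` meets `H` only if `f ∣ m`.  Then
`∑_{y ∈ I} [τ⁻¹ φ^m y τ ∈ H] F(τ⁻¹ φ^m y τ) = [f ∣ m] ∑_{z ∈ H ∩ τ⁻¹ I τ} F(φ'^{m/f} z)`:
indeed `τ⁻¹ φ^m I τ ∩ H = φ'^{m/f} (H ∩ τ⁻¹ I τ)` when `f ∣ m`.
Ref: Neukirch, *Algebraic Number Theory*, VII §10, proof of (10.4) (iv) (the Frobenius
`φᵢ = τᵢ⁻¹ φ^{fᵢ} τᵢ` of `𝔓ᵢ` over the intermediate field). [folklore] -/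
theorem sum_ite_conj_mem_eq_ite_dvd [Fintype I] [DecidablePred (· ∈ H)] {τ : G}
    [Fintype ↥(H ⊓ I.comap (MulAut.conj τ).toMonoidHom)]
    (hIn : ∀ d ∈ D, ∀ y ∈ I, d⁻¹ * y * d ∈ I) (hφ : φ ∈ D) (F : G → M) {φ' : G} {f : ℕ}
    (hf0 : f ≠ 0) (hφ'H : φ' ∈ H) (hφ'I : ∃ y ∈ I, φ' = τ⁻¹ * (φ ^ f * y * τ))
    (hf : ∀ m : ℕ, (∃ y ∈ I, τ⁻¹ * (φ ^ m * y * τ) ∈ H) → f ∣ m) (m : ℕ) :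
    (∑ y : I, if τ⁻¹ * (φ ^ m * y * τ) ∈ H then F (τ⁻¹ * (φ ^ m * y * τ)) else 0) =
      if f ∣ m then ∑ z : ↥(H ⊓ I.comap (MulAut.conj τ).toMonoidHom), F (φ' ^ (m / f) * z)
      else 0 := by
  split_ifs with hfm
  · obtain ⟨q, rfl⟩ := hfm
    rw [Nat.mul_div_cancel_left q (Nat.pos_of_ne_zero hf0)]
    obtain ⟨y₁, hy₁, hq⟩ := exists_pow_eq_conj hIn hφ hφ'I q
    rw [← Finset.sum_filter]
    have hjI : ∀ z : ↥(H ⊓ I.comap (MulAut.conj τ).toMonoidHom), τ * ↑z * τ⁻¹ ∈ I := fun z =>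
      Subgroup.mem_comap.mp (Subgroup.mem_inf.mp z.2).2
    have hiHI : ∀ y : I, τ⁻¹ * (φ ^ (f * q) * ↑y * τ) ∈ H →
        τ⁻¹ * (y₁⁻¹ * y) * τ ∈ H ⊓ I.comap (MulAut.conj τ).toMonoidHom := by
      intro y hy
      refine Subgroup.mem_inf.mpr ⟨?_, Subgroup.mem_comap.mpr ?_⟩
      · have : τ⁻¹ * (y₁⁻¹ * ↑y) * τ = (φ' ^ q)⁻¹ * (τ⁻¹ * (φ ^ (f * q) * ↑y * τ)) := by
          rw [hq]; group
        rw [this]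
        exact H.mul_mem (H.inv_mem (H.pow_mem hφ'H q)) hy
      · change τ * (τ⁻¹ * (y₁⁻¹ * ↑y) * τ) * τ⁻¹ ∈ I
        rw [show τ * (τ⁻¹ * (y₁⁻¹ * ↑y) * τ) * τ⁻¹ = y₁⁻¹ * ↑y by group]
        exact I.mul_mem (I.inv_mem hy₁) y.2
    refine Finset.sum_bij'
      (fun y hy => ⟨τ⁻¹ * (y₁⁻¹ * y) * τ, hiHI y (Finset.mem_filter.mp hy).2⟩)
      (fun z _ => ⟨y₁ * (τ * z * τ⁻¹), I.mul_mem hy₁ (hjI z)⟩) ?_ ?_ ?_ ?_ ?_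
    · intro y hy; exact Finset.mem_univ _
    · intro z _
      refine Finset.mem_filter.mpr ⟨Finset.mem_univ _, ?_⟩
      change τ⁻¹ * (φ ^ (f * q) * (y₁ * (τ * ↑z * τ⁻¹)) * τ) ∈ H
      rw [show τ⁻¹ * (φ ^ (f * q) * (y₁ * (τ * ↑z * τ⁻¹)) * τ) =
        (τ⁻¹ * (φ ^ (f * q) * y₁ * τ)) * ↑z by group, ← hq]
      exact H.mul_mem (H.pow_mem hφ'H q) (Subgroup.mem_inf.mp z.2).1
    · intro y hy; apply Subtype.ext; change y₁ * (τ * (τ⁻¹ * (y₁⁻¹ * ↑y) * τ) * τ⁻¹) = ↑y; group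
    · intro z _; apply Subtype.ext
      change τ⁻¹ * (y₁⁻¹ * (y₁ * (τ * ↑z * τ⁻¹))) * τ = ↑z; group
    · intro y hy
      congr 1
      change τ⁻¹ * (φ ^ (f * q) * ↑y * τ) = φ' ^ q * (τ⁻¹ * (y₁⁻¹ * ↑y) * τ)
      rw [hq]; group
  · refine Finset.sum_eq_zero fun y _ => ?_
    rw [if_neg]
    intro hy
    exact hfm (hf m ⟨y, y.2, hy⟩)

/-- For `g ∈ G` and the chosen representative `c.out` of the coset `c = gH`:
`c.out⁻¹ * g ∈ H`. [folklore] -/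
theorem out_inv_mul_mem (H : Subgroup G) (g : G) : (QuotientGroup.mk (s := H) g).out⁻¹ * g ∈ H := by
  rw [← QuotientGroup.eq, QuotientGroup.out_eq']

/-- Membership in a `D`-orbit on `G/H`: `c ∈ D · τH ↔ c = dτH` for some `d ∈ D`. [folklore] -/
theorem mem_orbit_coe_iff (τ : G) (c : G ⧸ H) :
    c ∈ MulAction.orbit D (τ : G ⧸ H) ↔ ∃ d ∈ D, c = ((d * τ : G) : G ⧸ H) := by
  rw [MulAction.mem_orbit_iff]
  constructor
  · rintro ⟨d, rfl⟩
    exact ⟨d, d.2, rfl⟩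
  · rintro ⟨d, hd, rfl⟩
    exact ⟨⟨d, hd⟩, rfl⟩

/-- Two translates `φ^a y τ H`, `φ^{a'} y' τ H` (`y, y' ∈ I`, `a ≤ a' < f + a`) of the coset `τH`
can only coincide if `a = a'` (minimality of `f`). [folklore] -/
theorem eq_of_translate_coset_eq (hIn : ∀ d ∈ D, ∀ y ∈ I, d⁻¹ * y * d ∈ I) (hφ : φ ∈ D)
    {τ : G} {f : ℕ} (hf : ∀ m : ℕ, (∃ y ∈ I, τ⁻¹ * (φ ^ m * y * τ) ∈ H) → f ∣ m)
    {a a' : ℕ} {y y' : G} (hy : y ∈ I) (hy' : y' ∈ I) (haa' : a ≤ a') (ha'f : a' < f + a)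
    (h : (φ ^ a * y * τ)⁻¹ * (φ ^ a' * y' * τ) ∈ H) : a = a' := by
  obtain ⟨n, rfl⟩ := Nat.exists_eq_add_of_le haa'
  suffices hn : n = 0 by rw [hn, add_zero]
  have hlt : n < f := by omega
  refine Nat.eq_zero_of_dvd_of_lt (hf n ⟨(φ ^ n)⁻¹ * y⁻¹ * φ ^ n * y',
    I.mul_mem (hIn _ (D.pow_mem hφ n) _ (I.inv_mem hy)) hy', ?_⟩) hlt
  have : τ⁻¹ * (φ ^ n * ((φ ^ n)⁻¹ * y⁻¹ * φ ^ n * y') * τ) =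
      (φ ^ a * y * τ)⁻¹ * (φ ^ (a + n) * y' * τ) := by
    rw [pow_add]; group
  rw [this]
  exact h

open scoped Classical in
/-- **Orbit count.**  With `φ' ∈ H ∩ τ⁻¹ φ^f I τ` and `f ≠ 0` minimal as above, the `D`-orbit of
the coset `τH` in `G/H` satisfies `|D · τH| · |H ∩ τ⁻¹ I τ| = f · |I|`: the map
`(a, y) ↦ φ^a y τ H`, `0 ≤ a < f`, `y ∈ I`, is onto the orbit with fibres the cosets of
`I ∩ τ H τ⁻¹`.  (In the arithmetic application: `e(𝔓|𝔭) f(𝔓|𝔭) = Σ`-type count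
`|D|/|D ∩ τHτ⁻¹| = f(𝔮|𝔭) · |I|/|I_𝔮|`.)
Ref: Neukirch, *Algebraic Number Theory*, VII §10, proof of (10.4) (iv); I (9.2)–(9.4). [folklore] -/
theorem card_orbit_mul_card_eq [Fintype G] (hID : I ≤ D) (hIn : ∀ d ∈ D, ∀ y ∈ I, d⁻¹ * y * d ∈ I) (hφ : φ ∈ D)
    (hgen : ∀ d ∈ D, ∃ a : ℕ, ∃ y ∈ I, d = φ ^ a * y) {τ φ' : G} {f : ℕ} (hf0 : f ≠ 0)
    (hφ'H : φ' ∈ H) (hφ'I : ∃ y ∈ I, φ' = τ⁻¹ * (φ ^ f * y * τ))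
    (hf : ∀ m : ℕ, (∃ y ∈ I, τ⁻¹ * (φ ^ m * y * τ) ∈ H) → f ∣ m) :
    Nat.card (MulAction.orbit D (τ : G ⧸ H)) *
        Nat.card ↥(H ⊓ I.comap (MulAut.conj τ).toMonoidHom) =
      f * Nat.card I := by
  rw [Nat.card_eq_card_toFinset, Nat.card_eq_fintype_card, Nat.card_eq_fintype_card]
  set O := (MulAction.orbit D (τ : G ⧸ H)).toFinset with hO
  set J := H ⊓ I.comap (MulAut.conj τ).toMonoidHom with hJ
  have hJI : ∀ z : J, τ * ↑z * τ⁻¹ ∈ I := fun z =>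
    Subgroup.mem_comap.mp (Subgroup.mem_inf.mp z.2).2
  have hJH : ∀ z : J, (z : G) ∈ H := fun z => (Subgroup.mem_inf.mp z.2).1
  -- the parametrisation of the orbit
  let Ψ : Fin f × I → G ⧸ H := fun p => ((φ ^ (p.1 : ℕ) * p.2 * τ : G) : G ⧸ H)
  have hΨO : ∀ p, Ψ p ∈ O := fun p => by
    rw [hO, Set.mem_toFinset, mem_orbit_coe_iff]
    exact ⟨φ ^ (p.1 : ℕ) * p.2, D.mul_mem (D.pow_mem hφ _) (hID p.2.2), rfl⟩
  -- surjectivity onto the orbit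
  have hsurj : ∀ c ∈ O, ∃ p, Ψ p = c := by
    intro c hc
    rw [hO, Set.mem_toFinset, mem_orbit_coe_iff] at hc
    obtain ⟨d, hd, rfl⟩ := hc
    obtain ⟨a, y, hy, rfl⟩ := hgen d hd
    obtain ⟨y₁, hy₁, hq⟩ := exists_pow_eq_conj hIn hφ hφ'I (a / f)
    set q := a / f with hqdef
    set r := a % f with hrdef
    have ha : a = r + f * q := (Nat.mod_add_div a f).symm
    set w := φ ^ (f * q) * y₁ with hwdef
    have hw : w = τ * φ' ^ q * τ⁻¹ := by rw [hq]; group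
    have hwD : w ∈ D := D.mul_mem (D.pow_mem hφ _) (hID hy₁)
    have hy₂ : w * (y₁⁻¹ * y) * w⁻¹ ∈ I := by
      have := hIn w⁻¹ (D.inv_mem hwD) (y₁⁻¹ * y) (I.mul_mem (I.inv_mem hy₁) hy)
      simpa only [inv_inv] using this
    have hφfq : φ ^ (f * q) = w * y₁⁻¹ := by rw [hwdef]; group
    refine ⟨(⟨r, Nat.mod_lt a (Nat.pos_of_ne_zero hf0)⟩, ⟨w * (y₁⁻¹ * y) * w⁻¹, hy₂⟩), ?_⟩
    change ((φ ^ r * (w * (y₁⁻¹ * y) * w⁻¹) * τ : G) : G ⧸ H) = ((φ ^ a * y * τ : G) : G ⧸ H)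
    rw [QuotientGroup.eq]
    have : (φ ^ r * (w * (y₁⁻¹ * y) * w⁻¹) * τ)⁻¹ * (φ ^ a * y * τ) = φ' ^ q := by
      rw [ha, pow_add, hφfq, hw]; group
    rw [this]
    exact H.pow_mem hφ'H q
  -- the fibres
  have hfib : ∀ p₀ : Fin f × I,
      (Finset.univ.filter fun p => Ψ p = Ψ p₀).card = Fintype.card J := by
    rintro ⟨a, y⟩
    have himage : (Finset.univ.filter fun p => Ψ p = Ψ (a, y)) =
        Finset.univ.image (fun z : J =>
          ((a, ⟨(y : G) * (τ * z * τ⁻¹), I.mul_mem y.2 (hJI z)⟩) : Fin f × I)) := by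
      ext ⟨a', y'⟩
      simp only [Finset.mem_filter, Finset.mem_univ, true_and, Finset.mem_image]
      constructor
      · intro h
        have h' : (φ ^ (a : ℕ) * ↑y * τ)⁻¹ * (φ ^ (a' : ℕ) * ↑y' * τ) ∈ H := by
          rw [← QuotientGroup.eq]; exact h.symm
        have haa : (a : ℕ) = a' := by
          rcases le_total (a : ℕ) a' with hle | hle
          · exact eq_of_translate_coset_eq hIn hφ hf y.2 y'.2 hle (by omega) h'
          · refine (eq_of_translate_coset_eq hIn hφ hf y'.2 y.2 hle (by omega) ?_).symm
            have := H.inv_mem h'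
            simpa only [mul_inv_rev, inv_inv, mul_assoc] using this
        obtain rfl : a' = a := Fin.ext haa.symm
        refine ⟨⟨τ⁻¹ * ((y : G)⁻¹ * y') * τ, ?_⟩, ?_⟩
        · refine Subgroup.mem_inf.mpr ⟨?_, Subgroup.mem_comap.mpr ?_⟩
          · have : τ⁻¹ * ((y : G)⁻¹ * ↑y') * τ =
                (φ ^ (a' : ℕ) * ↑y * τ)⁻¹ * (φ ^ (a' : ℕ) * ↑y' * τ) := by group
            rw [this]; exact h'
          · change τ * (τ⁻¹ * ((y : G)⁻¹ * ↑y') * τ) * τ⁻¹ ∈ I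
            rw [show τ * (τ⁻¹ * ((y : G)⁻¹ * ↑y') * τ) * τ⁻¹ = (y : G)⁻¹ * ↑y' by group]
            exact I.mul_mem (I.inv_mem y.2) y'.2
        · refine Prod.ext rfl (Subtype.ext ?_)
          change (y : G) * (τ * (τ⁻¹ * ((y : G)⁻¹ * ↑y') * τ) * τ⁻¹) = y'
          group
      · rintro ⟨z, hz⟩
        rw [← hz]
        change ((φ ^ (a : ℕ) * ((y : G) * (τ * ↑z * τ⁻¹)) * τ : G) : G ⧸ H) =
          ((φ ^ (a : ℕ) * ↑y * τ : G) : G ⧸ H)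
        rw [QuotientGroup.eq]
        have : (φ ^ (a : ℕ) * ((y : G) * (τ * ↑z * τ⁻¹)) * τ)⁻¹ * (φ ^ (a : ℕ) * ↑y * τ) =
            (z : G)⁻¹ := by group
        rw [this]
        exact H.inv_mem (hJH z)
    rw [himage, Finset.card_image_of_injective _ ?_, Finset.card_univ]
    intro z₁ z₂ h
    simp only [Prod.mk.injEq, true_and, Subtype.mk.injEq] at h
    exact Subtype.ext (by simpa using h)
  -- count
  have hcount := Finset.card_eq_sum_card_fiberwise (s := (Finset.univ : Finset (Fin f × I)))
    (t := O) (f := Ψ) fun p _ => hΨO p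
  rw [Finset.card_univ, Fintype.card_prod, Fintype.card_fin] at hcount
  rw [hcount, Finset.sum_congr rfl fun c hc => ?_, Finset.sum_const, smul_eq_mul]
  obtain ⟨p₀, rfl⟩ := hsurj c hc
  exact hfib p₀

open scoped Classical in
/-- **Regrouping the cosets by double cosets.**  If `τ : ι → G` is a system of representatives
of `D\G/H` and `S : G → M` is left `D`- and right `H`-invariant, then
`∑_{c ∈ G/H} S(c.out) = ∑_i |D · τᵢH| · S(τᵢ)`. [folklore] -/
theorem sum_quotient_out_eq_sum_card_orbit_smul [Fintype (G ⧸ H)] {ι : Type*} [Fintype ι]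
    (τ : ι → G) (h1 : ∀ x : G, ∃ i, ∃ d ∈ D, ∃ h ∈ H, x = d * τ i * h)
    (h2 : ∀ i j, (∃ d ∈ D, ∃ h ∈ H, τ j = d * τ i * h) → i = j) (S : G → M)
    (hSD : ∀ d ∈ D, ∀ t, S (d * t) = S t) (hSH : ∀ h ∈ H, ∀ t, S (t * h) = S t) :
    ∑ c : G ⧸ H, S c.out =
      ∑ i, Nat.card (MulAction.orbit D (τ i : G ⧸ H)) • S (τ i) := by
  set O : ι → Finset (G ⧸ H) := fun i => (MulAction.orbit D (τ i : G ⧸ H)).toFinset with hO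
  have hmemO : ∀ i c, c ∈ O i ↔ ∃ d ∈ D, c = ((d * τ i : G) : G ⧸ H) := fun i c => by
    rw [hO, Set.mem_toFinset, mem_orbit_coe_iff]
  have hcover : (Finset.univ : Finset (G ⧸ H)) = Finset.univ.biUnion O := by
    ext c
    simp only [Finset.mem_univ, Finset.mem_biUnion, true_and, true_iff]
    induction c using QuotientGroup.induction_on with
    | H x =>
      obtain ⟨i, d, hd, h, hh, rfl⟩ := h1 x
      refine ⟨i, (hmemO i _).mpr ⟨d, hd, ?_⟩⟩
      rw [QuotientGroup.eq, show (d * τ i * h)⁻¹ * (d * τ i) = h⁻¹ by group]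
      exact H.inv_mem hh
  have hdisj : (↑(Finset.univ : Finset ι) : Set ι).PairwiseDisjoint O := by
    intro i _ j _ hij
    rw [Function.onFun, Finset.disjoint_left]
    intro c hci hcj
    apply hij
    obtain ⟨d, hd, rfl⟩ := (hmemO i c).mp hci
    obtain ⟨d', hd', hc⟩ := (hmemO j _).mp hcj
    rw [QuotientGroup.eq] at hc
    refine h2 i j ⟨d'⁻¹ * d, D.mul_mem (D.inv_mem hd') hd, _, hc, by group⟩
  have hconst : ∀ i, ∀ c ∈ O i, S c.out = S (τ i) := by
    intro i c hc
    obtain ⟨d, hd, rfl⟩ := (hmemO i c).mp hc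
    have hh := H.inv_mem (out_inv_mul_mem H (d * τ i))
    rw [mul_inv_rev, inv_inv] at hh
    calc S (((d * τ i : G) : G ⧸ H)).out
        = S ((d * τ i) * ((d * τ i)⁻¹ * (((d * τ i : G) : G ⧸ H)).out)) := by
          congr 1; group
      _ = S (d * τ i) := hSH _ hh _
      _ = S (τ i) := hSD d hd _
  calc ∑ c : G ⧸ H, S c.out = ∑ c ∈ Finset.univ.biUnion O, S c.out := by rw [← hcover]
    _ = ∑ i, ∑ c ∈ O i, S c.out := Finset.sum_biUnion hdisj
    _ = ∑ i, Nat.card (MulAction.orbit D (τ i : G ⧸ H)) • S (τ i) := by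
      refine Finset.sum_congr rfl fun i _ => ?_
      rw [Finset.sum_congr rfl (hconst i), Finset.sum_const, Nat.card_eq_card_toFinset]

end Combinatorics

/-! ### The character of an induced representation (Serre §3.3, Thm. 12) -/

section InducedCharacter

variable {k : Type*} [Field k] {G : Type*} [Group G]
  {V : Type*} [AddCommGroup V] [Module k V]
  (ρ : Representation k G V) (H : Subgroup G) (W₀ : Subrepresentation (ρ.comp H.subtype))

/-- The action of `W₀.toRepresentation h` is that of `ρ h` on the underlying vectors. [folklore] -/
theorem coe_toRepresentation_apply (h : H) (w : W₀.toSubmodule) :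
    ((W₀.toRepresentation h w : W₀.toSubmodule) : V) = ρ h w := rfl

/-- An `H`-stable subspace is mapped onto itself by every `h ∈ H`. [folklore] -/
theorem map_toSubmodule_eq_of_mem {h : G} (hh : h ∈ H) :
    W₀.toSubmodule.map (ρ h) = W₀.toSubmodule := by
  apply le_antisymm
  · rintro _ ⟨w, hw, rfl⟩
    exact W₀.apply_mem_toSubmodule ⟨h, hh⟩ hw
  · intro w hw
    refine ⟨ρ h⁻¹ w, W₀.apply_mem_toSubmodule ⟨h⁻¹, H.inv_mem hh⟩ hw, ?_⟩
    rw [← Module.End.mul_apply, ← map_mul, mul_inv_cancel, map_one, Module.End.one_apply]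

/-- The translate `ρ(g) W₀` only depends on the coset `gH`: it equals `ρ(c.out) W₀` for
`c = gH`. [folklore] -/
theorem map_toSubmodule_eq_map_out (g : G) :
    W₀.toSubmodule.map (ρ g) = W₀.toSubmodule.map (ρ (QuotientGroup.mk (s := H) g).out) := by
  set t := (QuotientGroup.mk (s := H) g).out
  have hg : g = t * (t⁻¹ * g) := by group
  conv_lhs => rw [hg, map_mul, Module.End.mul_eq_comp, Submodule.map_comp,
    map_toSubmodule_eq_of_mem ρ H W₀ (out_inv_mul_mem H g)]

variable [Fintype (G ⧸ H)]

/-- **Serre's basis of an induced representation.**  If the translates `ρ(g) W₀` span `V` and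
`dim V = [G:H] dim W₀`, then the vectors `ρ(c.out) b s` (`c ∈ G/H`, `b` a basis of `W₀`) are
linearly independent (and span `V`).
Ref: Serre, *Linear Representations of Finite Groups*, §3.3 (`V = ⊕_{σ ∈ G/H} σ W`).
[cite: SerreLinearRepresentations1977, §3.3] -/
theorem linearIndependent_translate_basis
    (hspan : ⨆ g : G, W₀.toSubmodule.map (ρ g) = ⊤)
    (hdim : Module.finrank k V = H.index * Module.finrank k W₀.toSubmodule)
    {n : ℕ} (b : Module.Basis (Fin n) k W₀.toSubmodule) :
    LinearIndependent k (fun p : (G ⧸ H) × Fin n => ρ p.1.out (b p.2 : V)) ∧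
      ⊤ ≤ Submodule.span k (Set.range fun p : (G ⧸ H) × Fin n => ρ p.1.out (b p.2 : V)) := by
  have hsp : ⊤ ≤ Submodule.span k (Set.range fun p : (G ⧸ H) × Fin n => ρ p.1.out (b p.2 : V)) := by
    rw [← hspan, iSup_le_iff]
    intro g
    rw [map_toSubmodule_eq_map_out ρ H W₀ g]
    rintro _ ⟨w, hw, rfl⟩
    have hw' : (⟨w, hw⟩ : W₀.toSubmodule) = ∑ s, b.repr ⟨w, hw⟩ s • b s := (b.sum_repr _).symm
    have hw'' : w = ∑ s, b.repr ⟨w, hw⟩ s • (b s : V) := by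
      simpa only [Submodule.coe_sum, Submodule.coe_smul] using congrArg Subtype.val hw'
    rw [hw'', map_sum]
    refine Submodule.sum_mem _ fun s _ => ?_
    rw [map_smul]
    exact Submodule.smul_mem _ _ (Submodule.subset_span ⟨(QuotientGroup.mk g, s), rfl⟩)
  refine ⟨linearIndependent_of_top_le_span_of_card_eq_finrank hsp ?_, hsp⟩
  rw [Fintype.card_prod, Fintype.card_fin, hdim, Module.finrank_eq_card_basis b, Fintype.card_fin,
    Subgroup.index_eq_card, Nat.card_eq_fintype_card]

variable [FiniteDimensional k V]

open scoped Classical in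
/-- **The character of an induced representation** (Serre, *Linear Representations of Finite
Groups*, §3.3, Thm. 12): if `V = ⊕_{c ∈ G/H} ρ(c) W₀` (translates spanning, `dim V = [G:H] dim W₀`),
then `tr ρ(x) = ∑_{c ∈ G/H, c.out⁻¹ x c.out ∈ H} tr(ρ(c.out⁻¹ x c.out) | W₀)`.
[cite: SerreLinearRepresentations1977, §3.3 Thm. 12] -/
theorem trace_eq_sum_quotient
    (hspan : ⨆ g : G, W₀.toSubmodule.map (ρ g) = ⊤)
    (hdim : Module.finrank k V = H.index * Module.finrank k W₀.toSubmodule) (x : G) :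
    LinearMap.trace k V (ρ x) =
      ∑ c : G ⧸ H, if hc : c.out⁻¹ * (x * c.out) ∈ H then
        LinearMap.trace k W₀.toSubmodule (W₀.toRepresentation ⟨_, hc⟩) else 0 := by
  set n := Module.finrank k W₀.toSubmodule
  let b : Module.Basis (Fin n) k W₀.toSubmodule := Module.finBasis k W₀.toSubmodule
  obtain ⟨hli, hsp⟩ := linearIndependent_translate_basis ρ H W₀ hspan hdim b
  let E : Module.Basis ((G ⧸ H) × Fin n) k V := Module.Basis.mk hli hsp
  have hE : ∀ p, E p = ρ p.1.out (b p.2 : V) := fun p => Module.Basis.mk_apply hli hsp p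
  -- the action of `ρ x` on the basis vectors of the block `c`
  have key : ∀ (c : G ⧸ H) (s : Fin n),
      ρ x (E (c, s)) = ∑ s', (LinearMap.toMatrix b b
        (W₀.toRepresentation ⟨(QuotientGroup.mk (s := H) (x * c.out)).out⁻¹ * (x * c.out),
          out_inv_mul_mem H _⟩)) s' s • E (QuotientGroup.mk (s := H) (x * c.out), s') := by
    intro c s
    set c' := QuotientGroup.mk (s := H) (x * c.out)
    set h' : H := ⟨c'.out⁻¹ * (x * c.out), out_inv_mul_mem H _⟩
    have hsum := b.sum_repr (W₀.toRepresentation h' (b s))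
    have hsum' : (ρ (h' : G) (b s : V)) =
        ∑ s', (b.repr (W₀.toRepresentation h' (b s)) s') • (b s' : V) := by
      have := congrArg Subtype.val hsum
      rw [coe_toRepresentation_apply] at this
      simpa only [Submodule.coe_sum, Submodule.coe_smul] using this.symm
    simp only [hE, LinearMap.toMatrix_apply]
    rw [← Module.End.mul_apply, ← map_mul]
    have hx : x * c.out = c'.out * (h' : G) := by
      change x * c.out = c'.out * (c'.out⁻¹ * (x * c.out)); group
    conv_lhs => rw [hx, map_mul, Module.End.mul_apply, hsum', map_sum]
    simp only [map_smul]
    rfl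
  -- trace in the basis `E`
  rw [LinearMap.trace_eq_matrix_trace k E, Matrix.trace, Fintype.sum_prod_type]
  refine Finset.sum_congr rfl fun c _ => ?_
  by_cases hc : c.out⁻¹ * (x * c.out) ∈ H
  · -- fixed coset: `x c = c`
    have hc' : QuotientGroup.mk (s := H) (x * c.out) = c := by
      conv_rhs => rw [← QuotientGroup.out_eq' c]
      rw [QuotientGroup.eq]
      have : (x * c.out)⁻¹ * c.out = (c.out⁻¹ * (x * c.out))⁻¹ := by group
      rw [this]
      exact H.inv_mem hc
    rw [dif_pos hc]
    simp only [Matrix.diag_apply, LinearMap.toMatrix_apply, key, map_sum, map_smul,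
      Module.Basis.repr_self, Finsupp.smul_single, smul_eq_mul, mul_one, Finsupp.coe_finsetSum,
      Finset.sum_apply, Finsupp.single_apply, Prod.mk.injEq, hc', true_and]
    rw [LinearMap.trace_eq_matrix_trace k b, Matrix.trace]
    refine Finset.sum_congr rfl fun s _ => ?_
    simp [Matrix.diag_apply, LinearMap.toMatrix_apply]
  · -- moved coset: all diagonal coefficients vanish
    have hc' : QuotientGroup.mk (s := H) (x * c.out) ≠ c := by
      intro h
      apply hc
      conv_rhs at h => rw [← QuotientGroup.out_eq' c]
      rw [QuotientGroup.eq] at h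
      have : (x * c.out)⁻¹ * c.out = (c.out⁻¹ * (x * c.out))⁻¹ := by group
      rw [this] at h
      exact (H.inv_mem_iff).mp h
    rw [dif_neg hc]
    simp only [Matrix.diag_apply, LinearMap.toMatrix_apply, key, map_sum, map_smul,
      Module.Basis.repr_self, Finsupp.smul_single, smul_eq_mul, mul_one, Finsupp.coe_finsetSum,
      Finset.sum_apply, Finsupp.single_apply, Prod.mk.injEq]
    refine Finset.sum_eq_zero fun s _ => Finset.sum_eq_zero fun s' _ => ?_
    rw [if_neg (fun h => hc' h.1)]

end InducedCharacter


/-! ### The main theorem -/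

section Main

variable {k : Type*} [Field k] [CharZero k] {G : Type*} [Group G] [Finite G]
  {V : Type*} [AddCommGroup V] [Module k V] [FiniteDimensional k V]
  (ρ : Representation k G V) (H : Subgroup G) (W₀ : Subrepresentation (ρ.comp H.subtype))
  {D I : Subgroup G} {φ : G} {ι : Type*} [Fintype ι] (τ : ι → G) (f : ι → ℕ) (φ' : ι → G)

omit [CharZero k] [Finite G] [FiniteDimensional k V] in
/-- The function `F(w) = tr(ρ(w) | W₀)` for `w ∈ H` (and `0` otherwise) is invariant under
`H`-conjugation. [folklore] -/
theorem trace_toRepresentation_conj [DecidablePred (· ∈ H)] {h w : G} (hh : h ∈ H) (hw : w ∈ H) :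
    (if hx : h⁻¹ * (w * h) ∈ H then
        LinearMap.trace k W₀.toSubmodule (W₀.toRepresentation ⟨_, hx⟩) else 0) =
      if hx : w ∈ H then LinearMap.trace k W₀.toSubmodule (W₀.toRepresentation ⟨_, hx⟩) else 0 := by
  have hx : h⁻¹ * (w * h) ∈ H := H.mul_mem (H.inv_mem hh) (H.mul_mem hw hh)
  rw [dif_pos hx, dif_pos hw]
  have : (⟨h⁻¹ * (w * h), hx⟩ : H) = ⟨h, hh⟩⁻¹ * (⟨w, hw⟩ * ⟨h, hh⟩) := rfl
  rw [this, map_mul W₀.toRepresentation, map_mul W₀.toRepresentation, LinearMap.trace_mul_comm,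
    mul_assoc, ← map_mul W₀.toRepresentation, mul_inv_cancel, map_one, mul_one]

/-- **Artin's computation of the Euler factor of an induced representation** (trace form).
Let `G` be a finite group, `ρ` a representation of `G` on `V` over a field of characteristic
zero which is induced from the `H`-stable subspace `W₀` (`V = ⊕_{c ∈ G/H} ρ(c) W₀`: the
translates span and `dim V = [G:H] dim W₀`).  Let `I ⊴ D ≤ G` with `D = ⋃ₐ φ^a I` (`φ ∈ D`), let
`τ : ι → G` be representatives of the double cosets `D \ G / H`, and for each `i` let
`φ'ᵢ ∈ H ∩ τᵢ⁻¹ φ^{fᵢ} I τᵢ` where `τᵢ⁻¹ φ^m I τᵢ` meets `H` only if `fᵢ ∣ m`.  Then for `m ≥ 1`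
`tr(ρ(φ)^m | V^I) = ∑ᵢ [fᵢ ∣ m] fᵢ · tr(ρ(φ'ᵢ)^{m/fᵢ} | W₀ ∩ V^{H ∩ τᵢ⁻¹ I τᵢ})`.
Ref: E. Artin, *Zur Theorie der L-Reihen mit allgemeinen Gruppencharakteren*, Abh. Math. Sem.
Hamburg 8 (1931), §2; Neukirch, *Algebraic Number Theory*, VII §10, proof of Prop. (10.4) (iv),
pp. 523–524. [cite: NeukirchANT1999, VII (10.4) (iv), proof] -/
theorem trace_pow_restrict_invariants_eq_sum
    (hspan : ⨆ g : G, W₀.toSubmodule.map (ρ g) = ⊤)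
    (hdim : Module.finrank k V = H.index * Module.finrank k W₀.toSubmodule)
    (hID : I ≤ D) (hIn : ∀ d ∈ D, ∀ y ∈ I, d⁻¹ * y * d ∈ I) (hφ : φ ∈ D)
    (hgen : ∀ d ∈ D, ∃ a : ℕ, ∃ y ∈ I, d = φ ^ a * y)
    (h1 : ∀ x : G, ∃ i, ∃ d ∈ D, ∃ h ∈ H, x = d * τ i * h)
    (h2 : ∀ i j, (∃ d ∈ D, ∃ h ∈ H, τ j = d * τ i * h) → i = j)
    (hφ'H : ∀ i, φ' i ∈ H) (hφ'I : ∀ i, ∃ y ∈ I, φ' i = (τ i)⁻¹ * (φ ^ f i * y * τ i))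
    (hf : ∀ i (m : ℕ), (∃ y ∈ I, (τ i)⁻¹ * (φ ^ m * y * τ i) ∈ H) → f i ∣ m)
    (hA : Set.MapsTo (ρ φ) ↑(Representation.invariants (ρ.comp I.subtype))
      ↑(Representation.invariants (ρ.comp I.subtype)))
    (hB : ∀ i, Set.MapsTo (ρ (φ' i))
      ↑(W₀.toSubmodule ⊓ Representation.invariants
        (ρ.comp (H ⊓ I.comap (MulAut.conj (τ i)).toMonoidHom).subtype))
      ↑(W₀.toSubmodule ⊓ Representation.invariants
        (ρ.comp (H ⊓ I.comap (MulAut.conj (τ i)).toMonoidHom).subtype)))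
    (m : ℕ) :
    LinearMap.trace k _ ((ρ φ).restrict hA ^ m) =
      ∑ i, if f i ∣ m then
        (f i : k) * LinearMap.trace k _ ((ρ (φ' i)).restrict (hB i) ^ (m / f i)) else 0 := by
  classical
  haveI : Fintype G := Fintype.ofFinite G
  -- notation
  set VI := Representation.invariants (ρ.comp I.subtype) with hVI
  set J : ι → Subgroup G := fun i => H ⊓ I.comap (MulAut.conj (τ i)).toMonoidHom with hJ
  set F : G → k := fun w => if hw : w ∈ H then
    LinearMap.trace k W₀.toSubmodule (W₀.toRepresentation ⟨w, hw⟩) else 0 with hF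
  have hFconj : ∀ h ∈ H, ∀ w ∈ H, F (h⁻¹ * (w * h)) = F w := fun h hh w hw => by
    simp only [hF]
    exact trace_toRepresentation_conj ρ H W₀ hh hw
  -- `fᵢ ≠ 0`
  have hf0 : ∀ i, f i ≠ 0 := by
    intro i hfi
    have hdvd := hf i (orderOf φ) ⟨1, I.one_mem, by
      rw [pow_orderOf_eq_one, one_mul, one_mul, inv_mul_cancel]; exact H.one_mem⟩
    rw [hfi, zero_dvd_iff] at hdvd
    exact (orderOf_pos φ).ne' hdvd
  -- Step 1: powers of restrictions
  have hAm : Set.MapsTo (ρ (φ ^ m)) ↑VI ↑VI := by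
    rw [map_pow]
    exact fun v hv => Module.End.pow_apply_mem_of_forall_mem m (fun x hx => hA hx) v hv
  have hpowA : (ρ φ).restrict hA ^ m = (ρ (φ ^ m)).restrict hAm := by
    rw [Module.End.pow_restrict m]
    congr 1
    rw [map_pow]
  -- Step 2: averaging over `I`
  have step2 : (Fintype.card I : k) * LinearMap.trace k VI ((ρ (φ ^ m)).restrict hAm) =
      ∑ y : I, LinearMap.trace k V (ρ (φ ^ m * y)) := by
    rw [card_mul_trace_restrict_invariants ρ I (ρ (φ ^ m)) hAm]
    simp only [map_mul, Module.End.mul_eq_comp]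
  -- Step 3: the induced character formula, in terms of `F`
  have step3 : ∀ x : G, LinearMap.trace k V (ρ x) =
      ∑ c : G ⧸ H, if c.out⁻¹ * (x * c.out) ∈ H then F (c.out⁻¹ * (x * c.out)) else 0 := by
    intro x
    rw [trace_eq_sum_quotient ρ H W₀ hspan hdim x]
    refine Finset.sum_congr rfl fun c _ => ?_
    by_cases hc : c.out⁻¹ * (x * c.out) ∈ H
    · rw [dif_pos hc, if_pos hc, hF]
      simp only [dif_pos hc]
    · rw [dif_neg hc, if_neg hc]
  -- the local sums `S(t)`
  set S : G → k := fun t => ∑ y : I,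
    if t⁻¹ * (φ ^ m * y * t) ∈ H then F (t⁻¹ * (φ ^ m * y * t)) else 0 with hS
  have hSD : ∀ d ∈ D, ∀ t, S (d * t) = S t := fun d hd t =>
    sum_ite_conj_mem_eq_of_mem hIn hφ hgen F m t hd
  have hSH : ∀ h ∈ H, ∀ t, S (t * h) = S t := fun h hh t => by
    simp only [hS]
    exact Finset.sum_congr rfl fun y _ => ite_conj_mem_mul_eq F hFconj _ t hh
  -- Steps 4–6: swap the sums and regroup by double cosets
  have step456 : ∑ y : I, LinearMap.trace k V (ρ (φ ^ m * y)) =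
      ∑ i, Nat.card (MulAction.orbit D (τ i : G ⧸ H)) • S (τ i) := by
    simp_rw [step3]
    rw [Finset.sum_comm]
    exact sum_quotient_out_eq_sum_card_orbit_smul τ h1 h2 S hSD hSH
  -- Step 7–8: evaluate `S(τᵢ)`
  have step78 : ∀ i, S (τ i) = if f i ∣ m then (Fintype.card (J i) : k) *
      LinearMap.trace k _ ((ρ (φ' i)).restrict (hB i) ^ (m / f i)) else 0 := by
    intro i
    simp only [hS]
    rw [sum_ite_conj_mem_eq_ite_dvd hIn hφ F (hf0 i) (hφ'H i) (hφ'I i) (hf i) m]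
    split_ifs with hdvd
    · -- averaging over `J i` inside `W₀`
      set q := m / f i
      have hBq : Set.MapsTo (ρ (φ' i ^ q))
          ↑(W₀.toSubmodule ⊓ Representation.invariants (ρ.comp (J i).subtype))
          ↑(W₀.toSubmodule ⊓ Representation.invariants (ρ.comp (J i).subtype)) := by
        rw [map_pow]
        exact fun v hv => Module.End.pow_apply_mem_of_forall_mem q (fun x hx => hB i hx) v hv
      have hpowB : (ρ (φ' i)).restrict (hB i) ^ q = (ρ (φ' i ^ q)).restrict hBq := by
        rw [Module.End.pow_restrict q]
        congr 1
        rw [map_pow]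
      have hU : ∀ j : J i, ∀ u ∈ W₀.toSubmodule, ρ j u ∈ W₀.toSubmodule := fun j u hu =>
        W₀.apply_mem_toSubmodule ⟨j, (Subgroup.mem_inf.mp j.2).1⟩ hu
      have hAj : ∀ j : J i, Set.MapsTo (ρ (φ' i ^ q) ∘ₗ ρ j) W₀.toSubmodule W₀.toSubmodule :=
        fun j u hu => W₀.apply_mem_toSubmodule ⟨φ' i ^ q, H.pow_mem (hφ'H i) q⟩ (hU j u hu)
      rw [hpowB, card_mul_trace_restrict_inf_invariants ρ (J i) W₀.toSubmodule hU _ hBq hAj]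
      refine Finset.sum_congr rfl fun z _ => ?_
      have hz : φ' i ^ q * ↑z ∈ H := H.mul_mem (H.pow_mem (hφ'H i) q) (Subgroup.mem_inf.mp z.2).1
      simp only [hF, dif_pos hz]
      congr 1
      ext w
      rw [coe_toRepresentation_apply, LinearMap.coe_restrict_apply, map_mul]
      rfl
    · rfl
  -- Step 9: the count `|D·τᵢH| |Jᵢ| = fᵢ |I|`
  have step9 : ∀ i, (Nat.card (MulAction.orbit D (τ i : G ⧸ H)) : k) * (Fintype.card (J i) : k)
      = (f i : k) * (Fintype.card I : k) := by
    intro i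
    have := card_orbit_mul_card_eq (H := H) hID hIn hφ hgen (hf0 i) (hφ'H i) (hφ'I i) (hf i)
    rw [Nat.card_eq_fintype_card (α := ↥(J i)), Nat.card_eq_fintype_card (α := ↥I)] at this
    exact_mod_cast this
  -- Step 10: assemble and cancel `|I|`
  have hI0 : (Fintype.card I : k) ≠ 0 := Nat.cast_ne_zero.mpr Fintype.card_ne_zero
  apply mul_left_cancel₀ hI0
  rw [hpowA, step2, step456, Finset.mul_sum]
  refine Finset.sum_congr rfl fun i _ => ?_
  rw [step78 i]
  split_ifs with hdvd
  · rw [nsmul_eq_mul, ← mul_assoc, step9 i]; ring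
  · rw [smul_zero, mul_zero]

omit [CharZero k] [Finite G] [FiniteDimensional k V] in
/-- `ρ(g)` preserves the invariants `V^J` of a subgroup normalised by `g`. [folklore] -/
theorem mapsTo_invariants_of_conj_mem (J : Subgroup G) {g : G} (hg : ∀ j ∈ J, g⁻¹ * j * g ∈ J) :
    Set.MapsTo (ρ g) ↑(Representation.invariants (ρ.comp J.subtype))
      ↑(Representation.invariants (ρ.comp J.subtype)) := by
  intro v hv
  rw [SetLike.mem_coe, Representation.mem_invariants] at hv ⊢
  intro j
  have h := hv ⟨g⁻¹ * j * g, hg j j.2⟩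
  simp only [MonoidHom.coe_comp, Function.comp_apply, Subgroup.subtype_apply] at h ⊢
  rw [map_mul, map_mul, Module.End.mul_apply, Module.End.mul_apply] at h
  have h' := congrArg (ρ g) h
  rwa [← Module.End.mul_apply, ← map_mul, mul_inv_cancel, map_one, Module.End.one_apply] at h'

omit [CharZero k] [Finite G] [FiniteDimensional k V] in
/-- The Frobenius `φ'ᵢ ∈ H ∩ τᵢ⁻¹ φ^{fᵢ} I τᵢ` preserves `W₀ ∩ V^{H ∩ τᵢ⁻¹ I τᵢ}`. [folklore] -/
theorem mapsTo_inf_invariants_of_frobenius (hID : I ≤ D)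
    (hIn : ∀ d ∈ D, ∀ y ∈ I, d⁻¹ * y * d ∈ I) (hφ : φ ∈ D) {τ φ' : G} {f : ℕ}
    (hφ'H : φ' ∈ H) (hφ'I : ∃ y ∈ I, φ' = τ⁻¹ * (φ ^ f * y * τ)) :
    Set.MapsTo (ρ φ')
      ↑(W₀.toSubmodule ⊓ Representation.invariants
        (ρ.comp (H ⊓ I.comap (MulAut.conj τ).toMonoidHom).subtype))
      ↑(W₀.toSubmodule ⊓ Representation.invariants
        (ρ.comp (H ⊓ I.comap (MulAut.conj τ).toMonoidHom).subtype)) := by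
  obtain ⟨y₀, hy₀, hφ'⟩ := hφ'I
  have hD : τ * φ' * τ⁻¹ ∈ D := by
    rw [hφ', show τ * (τ⁻¹ * (φ ^ f * y₀ * τ)) * τ⁻¹ = φ ^ f * y₀ by group]
    exact D.mul_mem (D.pow_mem hφ f) (hID hy₀)
  have hnorm : ∀ j ∈ H ⊓ I.comap (MulAut.conj τ).toMonoidHom,
      φ'⁻¹ * j * φ' ∈ H ⊓ I.comap (MulAut.conj τ).toMonoidHom := by
    intro j hj
    obtain ⟨hjH, hjI⟩ := Subgroup.mem_inf.mp hj
    rw [Subgroup.mem_comap] at hjI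
    refine Subgroup.mem_inf.mpr ⟨H.mul_mem (H.mul_mem (H.inv_mem hφ'H) hjH) hφ'H,
      Subgroup.mem_comap.mpr ?_⟩
    change τ * (φ'⁻¹ * j * φ') * τ⁻¹ ∈ I
    have := hIn _ hD _ hjI
    rw [show (τ * φ' * τ⁻¹)⁻¹ * (MulAut.conj τ).toMonoidHom j * (τ * φ' * τ⁻¹) =
      τ * (φ'⁻¹ * j * φ') * τ⁻¹ by simp [MulAut.conj_apply]; group] at this
    exact this
  intro v hv
  exact ⟨W₀.apply_mem_toSubmodule ⟨φ', hφ'H⟩ hv.1, mapsTo_invariants_of_conj_mem ρ _ hnorm hv.2⟩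

/-- **Artin's theorem on the Euler factor of an induced representation** (E. Artin 1931, §2;
Neukirch, *Algebraic Number Theory*, VII (10.4) (iv), proof, pp. 523–524), finite-group form.
Let `G` be a finite group and `ρ` a representation of `G` over a field of characteristic zero
induced from the `H`-stable subspace `W₀` (`V = ⊕_{c ∈ G/H} ρ(c) W₀`, Serre §3.3).  Let
`I ⊴ D ≤ G` with `D/I` generated by `φ` ("decomposition group, inertia group, Frobenius"), let
`τ : ι → G` be representatives of the double cosets `D \ G / H` ("the primes `𝔓ᵢ` of the
intermediate field above `𝔭`"), and for each `i` let `φ'ᵢ ∈ H ∩ τᵢ⁻¹ φ^{fᵢ} I τᵢ` with `fᵢ`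
minimal ("the Frobenius and residue degree of `𝔓ᵢ`").  Then
`det(1 - t ρ(φ) | V^I) = ∏ᵢ det(1 - t^{fᵢ} ρ(φ'ᵢ) | W₀^{H ∩ τᵢ⁻¹ I τᵢ})`, i.e. Neukirch's
`det(1 - φt; V^{I}) = ∏ᵢ det(1 - φᵢ t^{fᵢ}; W^{Iᵢ})` (in terms of `Polynomial.reverse` of the
characteristic polynomials and `Polynomial.expand`).  The maps-to hypotheses `hA`, `hB` hold
automatically (`mapsTo_invariants_of_conj_mem`, `mapsTo_inf_invariants_of_frobenius`); see
`reverse_charpoly_restrict_invariants_eq_prod'`.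
[cite: NeukirchANT1999, VII (10.4) (iv), proof pp. 523–524] [cite: ArtinHamburg1931, §2] -/
theorem reverse_charpoly_restrict_invariants_eq_prod
    (hspan : ⨆ g : G, W₀.toSubmodule.map (ρ g) = ⊤)
    (hdim : Module.finrank k V = H.index * Module.finrank k W₀.toSubmodule)
    (hID : I ≤ D) (hIn : ∀ d ∈ D, ∀ y ∈ I, d⁻¹ * y * d ∈ I) (hφ : φ ∈ D)
    (hgen : ∀ d ∈ D, ∃ a : ℕ, ∃ y ∈ I, d = φ ^ a * y)
    (h1 : ∀ x : G, ∃ i, ∃ d ∈ D, ∃ h ∈ H, x = d * τ i * h)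
    (h2 : ∀ i j, (∃ d ∈ D, ∃ h ∈ H, τ j = d * τ i * h) → i = j)
    (hφ'H : ∀ i, φ' i ∈ H) (hφ'I : ∀ i, ∃ y ∈ I, φ' i = (τ i)⁻¹ * (φ ^ f i * y * τ i))
    (hf : ∀ i (m : ℕ), (∃ y ∈ I, (τ i)⁻¹ * (φ ^ m * y * τ i) ∈ H) → f i ∣ m)
    (hA : Set.MapsTo (ρ φ) ↑(Representation.invariants (ρ.comp I.subtype))
      ↑(Representation.invariants (ρ.comp I.subtype)))
    (hB : ∀ i, Set.MapsTo (ρ (φ' i))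
      ↑(W₀.toSubmodule ⊓ Representation.invariants
        (ρ.comp (H ⊓ I.comap (MulAut.conj (τ i)).toMonoidHom).subtype))
      ↑(W₀.toSubmodule ⊓ Representation.invariants
        (ρ.comp (H ⊓ I.comap (MulAut.conj (τ i)).toMonoidHom).subtype))) :
    ((ρ φ).restrict hA).charpoly.reverse =
      ∏ i, Polynomial.expand k (f i) ((ρ (φ' i)).restrict (hB i)).charpoly.reverse := by
  have hf0 : ∀ i, f i ≠ 0 := by
    intro i hfi
    have hdvd := hf i (orderOf φ) ⟨1, I.one_mem, by
      rw [pow_orderOf_eq_one, one_mul, one_mul, inv_mul_cancel]; exact H.one_mem⟩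
    rw [hfi, zero_dvd_iff] at hdvd
    exact (orderOf_pos φ).ne' hdvd
  exact reverse_charpoly_eq_prod_expand_of_trace_pow _ (fun i => (ρ (φ' i)).restrict (hB i)) f
    hf0 fun m _ => trace_pow_restrict_invariants_eq_sum ρ H W₀ τ f φ' hspan hdim hID hIn hφ hgen
      h1 h2 hφ'H hφ'I hf hA hB m

/-- **Artin's theorem on the Euler factor of an induced representation**, with the maps-to
facts supplied (same statement as `reverse_charpoly_restrict_invariants_eq_prod`).
[cite: NeukirchANT1999, VII (10.4) (iv), proof pp. 523–524] [cite: ArtinHamburg1931, §2] -/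
theorem reverse_charpoly_restrict_invariants_eq_prod'
    (hspan : ⨆ g : G, W₀.toSubmodule.map (ρ g) = ⊤)
    (hdim : Module.finrank k V = H.index * Module.finrank k W₀.toSubmodule)
    (hID : I ≤ D) (hIn : ∀ d ∈ D, ∀ y ∈ I, d⁻¹ * y * d ∈ I) (hφ : φ ∈ D)
    (hgen : ∀ d ∈ D, ∃ a : ℕ, ∃ y ∈ I, d = φ ^ a * y)
    (h1 : ∀ x : G, ∃ i, ∃ d ∈ D, ∃ h ∈ H, x = d * τ i * h)
    (h2 : ∀ i j, (∃ d ∈ D, ∃ h ∈ H, τ j = d * τ i * h) → i = j)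
    (hφ'H : ∀ i, φ' i ∈ H) (hφ'I : ∀ i, ∃ y ∈ I, φ' i = (τ i)⁻¹ * (φ ^ f i * y * τ i))
    (hf : ∀ i (m : ℕ), (∃ y ∈ I, (τ i)⁻¹ * (φ ^ m * y * τ i) ∈ H) → f i ∣ m) :
    ((ρ φ).restrict (mapsTo_invariants_of_conj_mem ρ I fun j hj => hIn φ hφ j hj)).charpoly.reverse =
      ∏ i, Polynomial.expand k (f i) ((ρ (φ' i)).restrict
        (mapsTo_inf_invariants_of_frobenius ρ H W₀ hID hIn hφ (hφ'H i) (hφ'I i))).charpoly.reverse :=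
  reverse_charpoly_restrict_invariants_eq_prod ρ H W₀ τ f φ' hspan hdim hID hIn hφ hgen h1 h2 hφ'H
    hφ'I hf _ _

end Main

end Literature.RepresentationTheory.FiniteGroups
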